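import Summits.AtomisticToContinuum.HydrodynamicLimit.Theorems.EquilibriumClampedCollisionalWindowLD.Negative.PulseCoarse
import Summits.AtomisticToContinuum.HydrodynamicLimit.Theorems.EquilibriumClampedCollisionalWindowLD.Negative.TorusTools

/-!
# The line lattice: slots, blocks, the labelled event, the certificate, the constants of the main estimate (helper file of the refutation of `EquilibriumClampedCollisionalWindowLD`, stmt-AtomisticToContinuum-13733; see `Cruxes/EquilibriumClampedCollisionalWindowLD/Disproof.lean` and the evidence WITNESS.md; no Theses declaration is asserted positively; refuter-cdisprove-stmt-AtomisticToContinuum-13733-0)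
-/

noncomputable section

open Real
open scoped InnerProductSpace

namespace Summit.AtomisticToContinuum.HydrodynamicLimit.Theorems

namespace EquilibriumClampedCollisionalWindowLDNegative

/-! ## The line lattice on `𝕋³`: slots, blocks, the event, the certificate -/

section Lattice

open Literature.Analysis.FluidPDE Literature.Analysis.FunctionSpaces
open Filter
open scoped Topology

/-- The lattice of the witness at one level: `L`, `n` (lines are indexed by `Fin n × Fin n`, each
carries `M = L n` slots), the block length `m`, the block parameters `P` (`P.K + 1 = m`,
`P.s = 1/M`, `P.ε` = the sphere diameter, `P.V` = driver speed, `P.r`/`P.u` = position /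
velocity tolerances) and the window `w`. [folklore] -/
structure Lat where
  /-- lines carry `L n` slots -/
  L : ℕ
  /-- there are `n²` lines -/
  n : ℕ
  /-- block length -/
  m : ℕ
  /-- block parameters -/
  P : Params
  /-- the time window -/
  w : ℝ

namespace Lat

variable (Λ : Lat)

/-- slots per line -/
def M : ℕ := Λ.L * Λ.n
/-- number of spheres -/
def Npart : ℕ := Λ.M * Λ.n * Λ.n
/-- the slots -/
abbrev Slot : Type := Fin Λ.M × Fin Λ.n × Fin Λ.n
/-- number of blocks per line -/
def Q : ℕ := Λ.M / Λ.m
/-- block index of a slot along its line -/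
def blk (ς : Λ.Slot) : ℕ := ς.1 / Λ.m
/-- local index of a slot in its block -/
def loc (ς : Λ.Slot) : ℕ := ς.1 % Λ.m
/-- a block is ACTIVE (carries a pulse) iff it is a full block lying in the region `x₀ ∈ [7/12, 11/12]`
where `∂₀ cos(2π x₀) ≥ π` -/
def Active (b : ℕ) : Prop :=
  b < Λ.Q ∧ (7 / 12 : ℝ) ≤ ((b * Λ.m : ℕ) : ℝ) * Λ.P.s ∧ (((b + 1) * Λ.m : ℕ) : ℝ) * Λ.P.s ≤ 11 / 12
/-- driver slots: the first slot of an active block -/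
def IsDriver (ς : Λ.Slot) : Prop := Λ.Active (Λ.blk ς) ∧ Λ.loc ς = 0
/-- transverse position of a line -/
def lineVec (ℓ : Fin Λ.n × Fin Λ.n) : E3 := ((ℓ.1 : ℝ) / Λ.n) • bv 1 + ((ℓ.2 : ℝ) / Λ.n) • bv 2
/-- lifted position of a slot -/
def slotVec (ς : Λ.Slot) : E3 := ((ς.1 : ℝ) * Λ.P.s) • bv 0 + Λ.lineVec ς.2
/-- lifted position of the first slot of block `b` on line `ℓ` -/
def blockVec (b : ℕ) (ℓ : Fin Λ.n × Fin Λ.n) : E3 := (((b * Λ.m : ℕ) : ℝ) * Λ.P.s) • bv 0 + Λ.lineVec ℓ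
/-- nominal velocity of a slot: `V e₀` for drivers, `0` otherwise -/
def drv (ς : Λ.Slot) : E3 := by
  classical
  exact if Λ.IsDriver ς then Λ.P.V • bv 0 else 0

/-- A slot index splits into block and local index. [folklore] -/
theorem blk_mul_add_loc (ς : Λ.Slot) : Λ.blk ς * Λ.m + Λ.loc ς = ς.1 := by
  unfold blk loc; exact Nat.div_add_mod' _ _

/-- The slot vector splits accordingly. [folklore] -/
theorem slotVec_eq (ς : Λ.Slot) :
    Λ.slotVec ς = Λ.blockVec (Λ.blk ς) ς.2 + ((Λ.loc ς : ℝ) * Λ.P.s) • bv 0 := by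
  unfold slotVec blockVec
  have h : ((ς.1 : ℕ) : ℝ) = ((Λ.blk ς * Λ.m : ℕ) : ℝ) + (Λ.loc ς : ℝ) := by
    rw [← Nat.cast_add, blk_mul_add_loc]
  rw [h, add_mul, add_smul]
  abel

/-- Configurations of `N + 1` spheres on `𝕋³`. [folklore] -/
abbrev Cfg (N : ℕ) : Type := Config (N + 1) (Fin 3) (UnitAddTorus (Fin 3))

variable {N : ℕ} (a : Fin (N + 1) ≃ Λ.Slot)

/-- The minimal-image offset of sphere `p` from its slot. [folklore] -/
def offset (z : Cfg N) (p : Fin (N + 1)) : E3 :=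
  Torus.reprSym ((z p).1 - Torus.proj (Λ.slotVec (a p)))

/-- A position is its slot plus its offset. [folklore] -/
theorem pos_eq_proj (z : Cfg N) (p : Fin (N + 1)) :
    (z p).1 = Torus.proj (Λ.slotVec (a p) + Λ.offset a z p) :=
  eq_proj_add_reprSym _ _

/-- **The labelled event**: every sphere within `r` of its slot, every velocity within `u` of the
slot's nominal velocity. [folklore] -/
def Ev : Set (Cfg N) := {z | ∀ p, ‖Λ.offset a z p‖ ≤ Λ.P.r ∧ ‖(z p).2 - Λ.drv (a p)‖ ≤ Λ.P.u}

/-- The slot of block `b`, local index `κ`, line `ℓ`. [folklore] -/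
def slotOf (b κ : ℕ) (ℓ : Fin Λ.n × Fin Λ.n) (h : b * Λ.m + κ < Λ.M) : Λ.Slot := (⟨b * Λ.m + κ, h⟩, ℓ)

/-- **The block data read off a configuration**: offsets and velocities of the spheres of block
`b` on line `ℓ` (zero beyond the line). [folklore] -/
def bdata (z : Cfg N) (b : ℕ) (ℓ : Fin Λ.n × Fin Λ.n) : BlockData E3 where
  ξ κ := if h : b * Λ.m + κ < Λ.M then Λ.offset a z (a.symm (Λ.slotOf b κ ℓ h)) else 0
  η κ := if h : b * Λ.m + κ < Λ.M then (z (a.symm (Λ.slotOf b κ ℓ h))).2 else 0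

/-- **The certificate**: pulses in the active blocks (block trajectories, projected to the torus),
free flight for everybody else. [folklore] -/
def cert (z : Cfg N) (t : ℝ) : Cfg N := fun p => by
  classical
  exact if Λ.Active (Λ.blk (a p)) then
    (Torus.proj (Λ.blockVec (Λ.blk (a p)) (a p).2 +
        pos Λ.P (bv 0) (Λ.bdata a z (Λ.blk (a p)) (a p).2) (Λ.loc (a p)) t),
      vel Λ.P (bv 0) (Λ.bdata a z (Λ.blk (a p)) (a p).2) (Λ.loc (a p)) t)
  else ((z p).1 + Torus.proj (t • (z p).2), (z p).2)

/-- Structural hypotheses on the lattice. -/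
structure OK : Prop where
  m_ge : 3 ≤ Λ.m
  K_eq : Λ.P.K + 1 = Λ.m
  n_pos : 0 < Λ.n
  M_pos : 0 < Λ.M
  s_eq : Λ.P.s = 1 / Λ.M
  sep : Λ.P.SepOK

/-- Window / chart / separation hypotheses on the lattice (all discharged asymptotically). -/
structure WinOK : Prop where
  ok : Λ.OK
  w_nn : 0 ≤ Λ.w
  w_le_T : Λ.w ≤ Λ.P.Tmax
  w_lt : Λ.w < ((Λ.P.K - 1 : ℕ) : ℝ) * Λ.P.θlo
  chart : ((Λ.P.K : ℝ) + 1) * Λ.P.s + 2 * Λ.P.fwd ≤ 1 / 4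
  maxv : max Λ.P.u Λ.P.ρs ≤ Λ.P.Vhi
  trans_sep : Λ.P.ε + 2 * Λ.P.fwd < 1 / Λ.n
  long_sep : Λ.P.ε + 2 * Λ.P.errA < Λ.P.s
  fe_le : 2 * (Λ.P.fwd + Λ.P.errA) ≤ Λ.P.s
  s_le : Λ.P.s ≤ 1 / 4

/-- The lifted position of sphere `p` at time `t` along the certificate. [folklore] -/
def liftPos (z : Cfg N) (t : ℝ) (p : Fin (N + 1)) : E3 := by
  classical
  exact if Λ.Active (Λ.blk (a p)) then
    Λ.blockVec (Λ.blk (a p)) (a p).2 + pos Λ.P (bv 0) (Λ.bdata a z (Λ.blk (a p)) (a p).2) (Λ.loc (a p)) t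
  else Λ.slotVec (a p) + Λ.offset a z p + t • (z p).2

/-- The velocity of sphere `p` at time `t` along the certificate. [folklore] -/
def certVel (z : Cfg N) (t : ℝ) (p : Fin (N + 1)) : E3 := by
  classical
  exact if Λ.Active (Λ.blk (a p)) then vel Λ.P (bv 0) (Λ.bdata a z (Λ.blk (a p)) (a p).2) (Λ.loc (a p)) t
  else (z p).2

variable {Λ a}

/-- The slot of a given block/local index is the expected one. [folklore] -/
theorem slotOf_blk_loc (ς : Λ.Slot) :
    Λ.slotOf (Λ.blk ς) (Λ.loc ς) ς.2 (by rw [blk_mul_add_loc]; exact ς.1.2) = ς := by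
  unfold slotOf
  ext <;> simp [blk_mul_add_loc]

/-- `loc_lt` (technical, see the section header). [folklore] -/
theorem loc_lt (hΛ : Λ.OK) (ς : Λ.Slot) : Λ.loc ς < Λ.m := Nat.mod_lt _ (by have := hΛ.m_ge; omega)

/-- `loc_le_K` (technical, see the section header). [folklore] -/
theorem loc_le_K (hΛ : Λ.OK) (ς : Λ.Slot) : Λ.loc ς ≤ Λ.P.K := by
  have := loc_lt hΛ ς; have := hΛ.K_eq; omega

/-- In a full block every local index is a slot of the line. [folklore] -/
theorem blk_slot_lt (hΛ : Λ.OK) {b : ℕ} (hb : b < Λ.Q) {κ : ℕ} (hκ : κ ≤ Λ.P.K) : b * Λ.m + κ < Λ.M := by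
  have hK := hΛ.K_eq
  have h1 : (b + 1) * Λ.m ≤ Λ.Q * Λ.m := Nat.mul_le_mul_right _ hb
  have h2 : Λ.Q * Λ.m ≤ Λ.M := Nat.div_mul_le_self _ _
  have : b * Λ.m + κ < (b + 1) * Λ.m := by rw [Nat.add_mul, one_mul]; omega
  omega

/-- The block data at a local index are those of the sphere sitting there. [folklore] -/
theorem bdata_ξ (hΛ : Λ.OK) (z : Cfg N) (p : Fin (N + 1)) (hb : Λ.blk (a p) < Λ.Q) :
    (Λ.bdata a z (Λ.blk (a p)) (a p).2).ξ (Λ.loc (a p)) = Λ.offset a z p := by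
  have h := blk_slot_lt hΛ hb (loc_le_K hΛ (a p))
  simp only [bdata, dif_pos h]
  have : Λ.slotOf (Λ.blk (a p)) (Λ.loc (a p)) (a p).2 h = a p := slotOf_blk_loc (a p)
  rw [this, Equiv.symm_apply_apply]

/-- `bdata_η` (technical, see the section header). [folklore] -/
theorem bdata_η (hΛ : Λ.OK) (z : Cfg N) (p : Fin (N + 1)) (hb : Λ.blk (a p) < Λ.Q) :
    (Λ.bdata a z (Λ.blk (a p)) (a p).2).η (Λ.loc (a p)) = (z p).2 := by
  have h := blk_slot_lt hΛ hb (loc_le_K hΛ (a p))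
  simp only [bdata, dif_pos h]
  have : Λ.slotOf (Λ.blk (a p)) (Λ.loc (a p)) (a p).2 h = a p := slotOf_blk_loc (a p)
  rw [this, Equiv.symm_apply_apply]

/-- The sphere at block `b`, local index `κ`, line `ℓ`. [folklore] -/
theorem blk_symm_slotOf (hΛ : Λ.OK) {b κ : ℕ} (hκ : κ < Λ.m) (ℓ : Fin Λ.n × Fin Λ.n) (h : b * Λ.m + κ < Λ.M) :
    Λ.blk (Λ.slotOf b κ ℓ h) = b ∧ Λ.loc (Λ.slotOf b κ ℓ h) = κ ∧ (Λ.slotOf b κ ℓ h).2 = ℓ := by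
  have hm : 0 < Λ.m := by have := hΛ.m_ge; omega
  refine ⟨?_, ?_, rfl⟩
  · show (b * Λ.m + κ) / Λ.m = b
    rw [Nat.add_comm, Nat.add_mul_div_right _ _ hm, Nat.div_eq_of_lt hκ, zero_add]
  · show (b * Λ.m + κ) % Λ.m = κ
    rw [Nat.add_comm, Nat.add_mul_mod_self_right, Nat.mod_eq_of_lt hκ]

/-- **The event controls the block data** of every active block. [folklore] -/
theorem dataOK_of_mem (hΛ : Λ.OK) {z : Cfg N} (hz : z ∈ Λ.Ev a) {b : ℕ} (hb : Λ.Active b)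
    (ℓ : Fin Λ.n × Fin Λ.n) : DataOK Λ.P (bv 0) (Λ.bdata a z b ℓ) := by
  classical
  have hK := hΛ.K_eq
  refine ⟨norm_bv 0, fun κ hκ => ?_, fun κ hκ1 hκ => ?_, ?_⟩
  · have h := blk_slot_lt hΛ hb.1 hκ
    simp only [bdata, dif_pos h]
    exact (hz _).1
  · have h := blk_slot_lt hΛ hb.1 hκ
    simp only [bdata, dif_pos h]
    have hκm : κ < Λ.m := by omega
    have hnd : ¬ Λ.IsDriver (Λ.slotOf b κ ℓ h) := by
      rintro ⟨-, h0⟩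
      rw [(blk_symm_slotOf hΛ (b := b) (κ := κ) hκm ℓ h).2.1] at h0
      omega
    have := (hz (a.symm (Λ.slotOf b κ ℓ h))).2
    rwa [Equiv.apply_symm_apply, drv, if_neg hnd, sub_zero] at this
  · have h : b * Λ.m + 0 < Λ.M := blk_slot_lt hΛ hb.1 (Nat.zero_le _)
    have hη : (Λ.bdata a z b ℓ).η 0 = (z (a.symm (Λ.slotOf b 0 ℓ h))).2 := by
      simp only [bdata, dif_pos h]
    rw [hη]
    have hm0 : 0 < Λ.m := by have := hΛ.m_ge; omega
    have hd : Λ.IsDriver (Λ.slotOf b 0 ℓ h) := by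
      obtain ⟨h1, h2, -⟩ := blk_symm_slotOf hΛ (b := b) (κ := 0) hm0 ℓ h
      exact ⟨by rw [h1]; exact hb, h2⟩
    have := (hz (a.symm (Λ.slotOf b 0 ℓ h))).2
    rwa [Equiv.apply_symm_apply, drv, if_pos hd] at this

/-- **The certificate starts at the configuration.** [folklore] -/
theorem cert_zero (hΛ : Λ.OK) {z : Cfg N} (hz : z ∈ Λ.Ev a) : Λ.cert a z 0 = z := by
  classical
  have hP := hΛ.sep.adm
  funext p
  unfold cert
  split_ifs with hb
  · have hD := dataOK_of_mem hΛ hz hb (a p).2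
    have hκ := loc_le_K hΛ (a p)
    have hK1 : 1 ≤ Λ.P.K := by have := hΛ.K_eq; have := hΛ.m_ge; omega
    rw [pos_zero hP hD hK1 hκ, vel_zero hP hD hK1 hκ, base, bdata_ξ hΛ z p hb.1, bdata_η hΛ z p hb.1]
    ext
    · rw [Λ.pos_eq_proj a z p, Λ.slotVec_eq (a p)]
      simp only
      abel
    · rfl
  · simp

/-! ### Constants of the main estimate (event probability bound, gain, exponent), drivers -/

/-- Gaussian-mass lower bound of a velocity ball of radius `u` centred at `c`:
`(4π/3) u³ · (2π)^{-3/2} e^{-(‖c‖+u)²/2}`. [folklore] -/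
def gaussBallB (c : E3) (u : ℝ) : ℝ :=
  (Real.pi * 4 / 3 * u ^ 3) * ((2 * Real.pi) ^ (-(3 : ℝ) / 2) * Real.exp (-(‖c‖ + u) ^ 2 / 2))

/-- The uniform lower bound on the Gibbs probability of one labelled event. [folklore] -/
def evB (Λ : Lat) (N : ℕ) : ℝ :=
  (Real.pi * 4 / 3 * Λ.P.r ^ 3) ^ (N + 1) * ∏ ς : Λ.Slot, gaussBallB (Λ.drv ς) Λ.P.u

/-- The per-transfer gain of the energy functional. [folklore] -/
def gainT (P : Params) : ℝ :=
  (2 - 4 * (2 * Real.pi * (P.errA + P.fwd) + Real.pi * P.ε)) * (P.ε * (1 - P.αn ^ 2 / 2)) *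
    (P.clo * (P.clo - 2 * P.u)) / 2

/-- Numeric side conditions for the gain (hold asymptotically). -/
structure GainOK (Λ : Lat) : Prop where
  h_le : 2 * Real.pi * (Λ.P.errA + Λ.P.fwd) + Real.pi * Λ.P.ε ≤ 1 / 2
  u_le : 2 * Λ.P.u ≤ Λ.P.clo

/-- The lower bound on the number of transfers used in the exponent. -/
def Tlow (Λ : Lat) (kw : ℕ) : ℝ := (Λ.M : ℝ) / (4 * Λ.m) * (Λ.n * Λ.n) * kw

/-- The exponent lower bound on the labelled events. -/
def Fmin (Λ : Lat) (N kw : ℕ) (β Z : ℝ) : ℝ :=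
  β * (Λ.w⁻¹ * (Λ.Tlow kw * gainT Λ.P)) -
    β * (|Z - 1| * (6 * Real.pi) * (((Λ.Q * (Λ.n * Λ.n) : ℕ) : ℝ) * Λ.P.Vhi + ((N : ℝ) + 1) * max Λ.P.u Λ.P.ρs))

/-- Drivers: the spheres launched at speed `V`. Their number is at most `Q n²`. [folklore] -/
theorem card_drivers_le (Λ : Lat) [DecidablePred Λ.IsDriver] :
    ((Finset.univ : Finset Λ.Slot).filter Λ.IsDriver).card ≤ Λ.Q * (Λ.n * Λ.n) := by
  classical
  have hcard : ((Finset.range Λ.Q) ×ˢ (Finset.univ : Finset (Fin Λ.n × Fin Λ.n))).card = Λ.Q * (Λ.n * Λ.n) := by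
    simp [Finset.card_product, Finset.card_univ, Fintype.card_prod, Fintype.card_fin]
  rw [← hcard]
  refine Finset.card_le_card_of_injOn (fun ς => (Λ.blk ς, ς.2)) ?_ ?_
  · intro ς hς
    simp only [Finset.coe_filter, Finset.mem_univ, true_and, Set.mem_setOf_eq] at hς
    simp only [Finset.coe_product, Finset.coe_range, Finset.coe_univ, Set.mem_prod, Set.mem_Iio, Set.mem_univ, and_true]
    exact hς.1.1
  · intro ς hς ς' hς' h
    simp only [Finset.coe_filter, Finset.mem_univ, true_and, Set.mem_setOf_eq] at hς hς'
    simp only [Prod.mk.injEq] at h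
    have hl : Λ.loc ς = Λ.loc ς' := by rw [hς.2, hς'.2]
    have h1 := Λ.blk_mul_add_loc ς
    have h2 := Λ.blk_mul_add_loc ς'
    exact Prod.ext (Fin.ext (by rw [← h1, ← h2, h.1, hl])) h.2

end Lat

end Lattice

end EquilibriumClampedCollisionalWindowLDNegative

end Summit.AtomisticToContinuum.HydrodynamicLimit.Theorems

end
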